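import Mathlib
import Summits.NavierStokesRegularity.NavierStokesRegularity.Theorems.ScenarioCensusHelicalSlabPressure
import HarnessLib

/-!
# Census row S6 (bounded helical steady flows): periodicity of the pressure — the flux bound and
# the conclusion

Support file for the scenario census of `NavierStokesRegularity` (cell `pub/ns-census`, block S,
row S6 = Han–Wang–Xie, arXiv:2312.10382, Thm 1.1, whose proof uses Lemma 2.7 = Bang–Gui–Wang–Xie
2025, "the pressure `P` is also a periodic function with respect to `z`" for BOUNDED flows in
`ℝ² × 𝕋`). Sequel of `…HelicalSlabPressure` (`steady_pressure_defect`, `pressure_flux_identity`):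

* `le_setIntegral_zSlab_cylCutoff` — `R² L ≤ ∫_{slab} φ_R` for `φ_R = cylCutoff R (2R)` (the cut-off
  is `1` on the box `(−R/2, R/2)² × (0, L)`);
* `pressure_flux_bound` — `|∫_{slab} φ_R ∂₃P| ≤ (96 C₀ K₁ L + 32 C₀ M² L) R` for a bounded steady
  flow with bounded gradient (`‖U‖ ≤ M`, `‖DU‖ ≤ K₁`; `C₀` the cut-off gradient constant);
* `steady_pressure_periodic` — **the pressure of a bounded, axially `L`-periodic, smooth steady
  Navier–Stokes flow on `ℝ³` (unit viscosity) is axially `L`-periodic**: the constant period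
  defect `c₀` satisfies `c₀ ∫_{slab} φ_R = L ∫_{slab} φ_R ∂₃P = O(R)` while `∫_{slab} φ_R ≥ R² L`.

No summit statement and no census row is proved in this file.

## References

* J. Han, Y. Wang, C. Xie, arXiv:2312.10382 (2023), Lemma 2.7. [HanWangXie2023]
* J. Bang, C. Gui, Y. Wang, C. Xie, J. Fluid Mech. 1005 (2025) A6 = arXiv:2205.13259, §2.
  [BangGuiWangXie2025]
-/

-- the summit and its single problem share the name (D-0017 nested layout)
set_option linter.dupNamespace false

noncomputable section

open MeasureTheory Set Function Filter InnerProductSpace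
open scoped Topology ENNReal NNReal RealInnerProductSpace Laplacian ContDiff

namespace Summit.NavierStokesRegularity.NavierStokesRegularity.Theorems.ScenarioCensus.HelicalSlab

open Literature.Analysis Literature.Analysis.FluidPDE
open Summit.NavierStokesRegularity.NavierStokesRegularity.Theorems.ScenarioCensus.PeriodicSlab

/-! ### One period of the cut-off has mass at least `R² L` -/

/-- **`R² L ≤ ∫_{zSlab L 0} cylCutoff R (2R)`** (`L, R > 0`): the cut-off equals `1` on the box
`(−R/2, R/2)² × (0, L)`, which lies in the slab and inside the cylinder `{ρ < R}`. -/
theorem le_setIntegral_zSlab_cylCutoff {L R : ℝ} (hL : 0 < L) (hR : 0 < R) :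
    R ^ 2 * L ≤ ∫ x in zSlab L 0, cylCutoff R (2 * R) x := by
  set φ : EuclideanSpace ℝ (Fin 3) → ℝ := cylCutoff R (2 * R) with hφ
  have hr2 : R < 2 * R := by linarith
  have hφc : Continuous φ := (contDiff_cylCutoff R (2 * R) (n := 0)).continuous
  have hφnn : ∀ x, 0 ≤ φ x := cylCutoff_nonneg R (2 * R)
  have hφone : ∀ x, cylRadius x ≤ R → φ x = 1 := fun x hx => cylCutoff_eq_one hR.le hr2 hx
  have hφzero : ∀ x, 2 * R ≤ cylRadius x → φ x = 0 := fun x hx => cylCutoff_eq_zero hR.le hr2 hx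
  have hφint : IntegrableOn φ (zSlab L 0) volume :=
    integrableOn_zSlab_of_eq_zero_of_le_cylRadius hφc hφzero L 0
  -- the box
  set lo : Fin 3 → ℝ := ![-(R / 2), -(R / 2), 0] with hlo
  set hi : Fin 3 → ℝ := ![R / 2, R / 2, L] with hhi
  set B : Set (EuclideanSpace ℝ (Fin 3)) :=
    (fun x : EuclideanSpace ℝ (Fin 3) => (WithLp.ofLp x : Fin 3 → ℝ)) ⁻¹'
      Set.pi univ (fun i => Ioo (lo i) (hi i)) with hB
  have hBm : MeasurableSet B :=
    (MeasurableSet.univ_pi fun i => measurableSet_Ioo).preimage (PiLp.continuous_ofLp 2 _).measurable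
  have hmemB : ∀ x ∈ B, -(R / 2) < x 0 ∧ x 0 < R / 2 ∧ -(R / 2) < x 1 ∧ x 1 < R / 2 ∧
      0 < x 2 ∧ x 2 < L := by
    intro x hx
    rw [hB, mem_preimage, mem_univ_pi] at hx
    have h0 := hx 0; have h1 := hx 1; have h2 := hx 2
    simp only [hlo, hhi, mem_Ioo, Matrix.cons_val_zero, Matrix.cons_val_one, Matrix.cons_val_two,
      Matrix.head_cons, Matrix.tail_cons] at h0 h1 h2
    exact ⟨h0.1, h0.2, h1.1, h1.2, h2.1, h2.2⟩
  have hBS : B ⊆ zSlab L 0 := fun x hx => by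
    obtain ⟨-, -, -, -, h2a, h2b⟩ := hmemB x hx
    rw [mem_zSlab]; simp only [Int.cast_zero, zero_mul, zero_add, one_mul]
    exact ⟨h2a.le, h2b⟩
  have hB1 : ∀ x ∈ B, φ x = 1 := fun x hx => by
    obtain ⟨h0a, h0b, h1a, h1b, -, -⟩ := hmemB x hx
    refine hφone x ?_
    have hsq : x 0 ^ 2 + x 1 ^ 2 ≤ R ^ 2 := by nlinarith
    calc cylRadius x = Real.sqrt (x 0 ^ 2 + x 1 ^ 2) := rfl
      _ ≤ Real.sqrt (R ^ 2) := Real.sqrt_le_sqrt hsq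
      _ = R := Real.sqrt_sq hR.le
  -- volume of the box
  have hvol : volume B = ENNReal.ofReal (R ^ 2 * L) := by
    calc volume B = volume (Set.pi univ (fun i => Ioo (lo i) (hi i))) :=
          (PiLp.volume_preserving_ofLp (Fin 3)).measure_preimage
            (MeasurableSet.univ_pi fun i => measurableSet_Ioo).nullMeasurableSet
      _ = ∏ i, ENNReal.ofReal (hi i - lo i) := Real.volume_pi_Ioo
      _ = ENNReal.ofReal (R ^ 2 * L) := by
          rw [Fin.prod_univ_three]
          simp only [hlo, hhi, Matrix.cons_val_zero, Matrix.cons_val_one, Matrix.cons_val_two,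
            Matrix.head_cons, Matrix.tail_cons, sub_neg_eq_add, sub_zero]
          rw [← ENNReal.ofReal_mul (by linarith), ← ENNReal.ofReal_mul (by positivity)]
          congr 1; ring
  calc R ^ 2 * L = (volume B).toReal := by rw [hvol, ENNReal.toReal_ofReal (by positivity)]
    _ = ∫ x in B, (1 : ℝ) := by rw [setIntegral_const, smul_eq_mul, mul_one, measureReal_def]
    _ = ∫ x in B, φ x := setIntegral_congr_fun hBm fun x hx => (hB1 x hx).symm
    _ ≤ ∫ x in zSlab L 0, φ x :=
        setIntegral_mono_set hφint (Eventually.of_forall hφnn) (Eventually.of_forall hBS)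

/-! ### The flux bound -/

/-- **The pressure flux bound.** For a steady classical flow `(U, P)` at unit viscosity, axially
`L`-periodic (`L > 0`), with `‖U‖ ≤ M` and `‖DU‖ ≤ K₁`, and the cylindrical cut-offs with
gradient constant `C₀`: `|∫_{zSlab L 0} φ_R ∂₃P| ≤ (96 C₀ K₁ L + 32 C₀ M² L) R` for `R ≥ 1`,
`φ_R = cylCutoff R (2R)`. -/
theorem pressure_flux_bound {L M K₁ C₀ : ℝ} (hL : 0 < L)
    {U : EuclideanSpace ℝ (Fin 3) → EuclideanSpace ℝ (Fin 3)} {P : EuclideanSpace ℝ (Fin 3) → ℝ}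
    (h : IsSteadyClassicalNS 1 0 U P) (hUper : IsAxiallyPeriodic L U)
    (hM : ∀ x, ‖U x‖ ≤ M) (hK₁ : ∀ x, ‖fderiv ℝ U x‖ ≤ K₁) (hC₀0 : 0 ≤ C₀)
    (hC₀ : ∀ (ρ₂ ρ₁ : ℝ), 0 ≤ ρ₂ → ρ₂ < ρ₁ → ∀ x : EuclideanSpace ℝ (Fin 3),
      ‖fderiv ℝ (cylCutoff ρ₂ ρ₁) x‖ ≤ C₀ / (ρ₁ - ρ₂))
    {R : ℝ} (hR : 1 ≤ R) :
    |∫ x in zSlab L 0, cylCutoff R (2 * R) x * fderiv ℝ P x eZ| ≤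
      (96 * C₀ * K₁ * L + 32 * C₀ * M ^ 2 * L) * R := by
  set b := EuclideanSpace.basisFun (Fin 3) ℝ with hb
  set S : Set (EuclideanSpace ℝ (Fin 3)) := zSlab L 0 with hS
  have hR0 : 0 < R := by linarith
  have hr2 : R < 2 * R := by linarith
  have hU1 : ContDiff ℝ 1 U := contDiff_infty.1 h.smooth_velocity 1
  have hUc : Continuous U := hU1.continuous
  have hDUc : Continuous (fderiv ℝ U) := hU1.continuous_fderiv one_ne_zero
  have hM0 : 0 ≤ M := (norm_nonneg _).trans (hM 0)
  have hK₁0 : 0 ≤ K₁ := (norm_nonneg _).trans (hK₁ 0)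
  have heZ : ‖(eZ : EuclideanSpace ℝ (Fin 3))‖ = 1 := by simp [eZ]
  -- the cut-off and the annulus
  set φ : EuclideanSpace ℝ (Fin 3) → ℝ := cylCutoff R (2 * R) with hφ
  have hφ1 : ContDiff ℝ 1 φ := contDiff_cylCutoff R (2 * R)
  have hφnn : ∀ x, 0 ≤ φ x := cylCutoff_nonneg R (2 * R)
  have hφle : ∀ x, φ x ≤ 1 := cylCutoff_le_one R (2 * R)
  have hφone : ∀ x, cylRadius x ≤ R → φ x = 1 := fun x hx => cylCutoff_eq_one hR0.le hr2 hx
  have hφzero : ∀ x, 2 * R ≤ cylRadius x → φ x = 0 := fun x hx => cylCutoff_eq_zero hR0.le hr2 hx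
  have hφper : IsAxiallyPeriodic L φ := isAxiallyPeriodic_cylCutoff L R (2 * R)
  have hDφn : ∀ x, ‖fderiv ℝ φ x‖ ≤ C₀ / R := fun x => by
    have := hC₀ R (2 * R) hR0.le hr2 x; rwa [show 2 * R - R = R by ring] at this
  set A : Set (EuclideanSpace ℝ (Fin 3)) := {x | R ≤ cylRadius x ∧ cylRadius x < 2 * R} with hA
  have hAm : MeasurableSet A :=
    (isClosed_le continuous_const continuous_cylRadius).measurableSet.inter
      (isOpen_lt continuous_cylRadius continuous_const).measurableSet
  set χ : EuclideanSpace ℝ (Fin 3) → ℝ := A.indicator fun _ => (1 : ℝ) with hχ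
  have hχm : Measurable χ := measurable_const.indicator hAm
  have hχnn : ∀ x, 0 ≤ χ x := fun x => Set.indicator_nonneg (fun _ _ => zero_le_one) x
  have hχle : ∀ x, χ x ≤ 1 := fun x => Set.indicator_le_self' (fun _ _ => zero_le_one) x
  have hχzero : ∀ x, 2 * R ≤ cylRadius x → χ x = 0 := fun x hx => by
    simp only [hχ, Set.indicator_apply, hA, mem_setOf_eq]
    rw [if_neg]; exact fun h' => absurd h'.2 (not_lt.2 hx)
  have hDφ : ∀ (x v : EuclideanSpace ℝ (Fin 3)), |fderiv ℝ φ x v| ≤ C₀ / R * χ x * ‖v‖ := by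
    intro x v
    by_cases hx : x ∈ A
    · have hχ1 : χ x = 1 := by simp [hχ, hx]
      rw [hχ1, mul_one, ← Real.norm_eq_abs]
      exact (ContinuousLinearMap.le_opNorm _ _).trans
        (mul_le_mul_of_nonneg_right (hDφn x) (norm_nonneg _))
    · have hD0 : fderiv ℝ φ x = 0 := by
        simp only [hA, mem_setOf_eq, not_and_or, not_le, not_lt] at hx
        rcases hx with hx | hx
        · have hmax : IsLocalMax φ x :=
            Eventually.of_forall fun y => by rw [hφone x hx.le]; exact hφle y
          exact hmax.fderiv_eq_zero
        · have hmin : IsLocalMin φ x :=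
            Eventually.of_forall fun y => by rw [hφzero x hx]; exact hφnn y
          exact hmin.fderiv_eq_zero
      rw [hD0]; simp only [zero_apply, abs_zero]
      exact mul_nonneg (mul_nonneg (div_nonneg hC₀0 hR0.le) (hχnn x)) (norm_nonneg _)
  -- the mass of the annulus period
  set V : ℝ := ∫ x in S, χ x with hVdef
  have hV : V ≤ 32 * L * R ^ 2 := by
    have h1 : V = volume.real (S ∩ A) := by
      rw [hVdef, hχ, setIntegral_indicator hAm, setIntegral_const, smul_eq_mul, mul_one]
    rw [h1, measureReal_def]
    refine ENNReal.toReal_le_of_le_ofReal (by positivity) ?_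
    calc volume (S ∩ A) ≤ volume (zSlab L 0 ∩ {x | cylRadius x < 2 * R}) :=
          measure_mono fun x hx => ⟨hx.1, hx.2.2⟩
      _ ≤ ENNReal.ofReal (8 * L * (2 * R) ^ 2) := volume_zSlab_inter_cyl_le hL (by linarith)
      _ = ENNReal.ofReal (32 * L * R ^ 2) := by ring_nf
  have hχ_int : IntegrableOn χ S volume :=
    integrableOn_zSlab_of_bound hL hχm.aestronglyMeasurable (ρ := 2 * R) hχzero (B := 1)
      fun x _ => by rw [Real.norm_eq_abs, abs_of_nonneg (hχnn x)]; exact hχle x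
  -- the identity
  have hid := pressure_flux_identity hL h hUper hφ1 hφper hφnn hφzero
  -- term bounds
  have hT1 : ∀ i, |∫ x in S, fderiv ℝ φ x (b i) * ⟪fderiv ℝ U x (b i), eZ⟫| ≤ C₀ * K₁ / R * V := by
    intro i
    have hbi : ‖b i‖ = 1 := b.orthonormal.1 i
    have hg_int : IntegrableOn (fun x => C₀ * K₁ / R * χ x) S volume := hχ_int.const_mul _
    have h1 := norm_integral_le_of_norm_le (μ := volume.restrict S) hg_int
      (Eventually.of_forall fun x => (?_ :
        ‖fderiv ℝ φ x (b i) * ⟪fderiv ℝ U x (b i), eZ⟫‖ ≤ C₀ * K₁ / R * χ x))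
    · rw [Real.norm_eq_abs] at h1
      refine h1.trans (le_of_eq ?_)
      rw [integral_const_mul]
    · rw [norm_mul, Real.norm_eq_abs]
      have h2 : |fderiv ℝ φ x (b i)| ≤ C₀ / R * χ x := by
        have := hDφ x (b i); rwa [hbi, mul_one] at this
      have h3 : ‖⟪fderiv ℝ U x (b i), eZ⟫‖ ≤ K₁ := by
        calc ‖⟪fderiv ℝ U x (b i), eZ⟫‖ ≤ ‖fderiv ℝ U x (b i)‖ * ‖(eZ : EuclideanSpace ℝ (Fin 3))‖ :=
              norm_inner_le_norm _ _
          _ ≤ ‖fderiv ℝ U x‖ * ‖b i‖ * 1 := by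
              rw [heZ]; exact mul_le_mul_of_nonneg_right (ContinuousLinearMap.le_opNorm _ _) zero_le_one
          _ ≤ K₁ := by rw [hbi, mul_one, mul_one]; exact hK₁ x
      have h5 : 0 ≤ C₀ / R * χ x := mul_nonneg (div_nonneg hC₀0 hR0.le) (hχnn x)
      calc |fderiv ℝ φ x (b i)| * ‖⟪fderiv ℝ U x (b i), eZ⟫‖ ≤ (C₀ / R * χ x) * K₁ :=
            mul_le_mul h2 h3 (norm_nonneg _) h5
        _ = C₀ * K₁ / R * χ x := by ring
  have hT1s : |∑ i, ∫ x in S, fderiv ℝ φ x (b i) * ⟪fderiv ℝ U x (b i), eZ⟫| ≤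
      3 * (C₀ * K₁ / R * V) := by
    refine (Finset.abs_sum_le_sum_abs _ _).trans ?_
    calc ∑ i, |∫ x in S, fderiv ℝ φ x (b i) * ⟪fderiv ℝ U x (b i), eZ⟫|
        ≤ ∑ _i : Fin 3, C₀ * K₁ / R * V := Finset.sum_le_sum fun i _ => hT1 i
      _ = 3 * (C₀ * K₁ / R * V) := by simp
  have hT2 : |∫ x in S, fderiv ℝ φ x (U x) * ⟪U x, eZ⟫| ≤ C₀ * M ^ 2 / R * V := by
    have hg_int : IntegrableOn (fun x => C₀ * M ^ 2 / R * χ x) S volume := hχ_int.const_mul _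
    have h1 := norm_integral_le_of_norm_le (μ := volume.restrict S) hg_int
      (Eventually.of_forall fun x => (?_ :
        ‖fderiv ℝ φ x (U x) * ⟪U x, eZ⟫‖ ≤ C₀ * M ^ 2 / R * χ x))
    · rw [Real.norm_eq_abs] at h1
      refine h1.trans (le_of_eq ?_)
      rw [integral_const_mul]
    · rw [norm_mul, Real.norm_eq_abs]
      have h2 : |fderiv ℝ φ x (U x)| ≤ C₀ / R * χ x * M :=
        (hDφ x (U x)).trans (mul_le_mul_of_nonneg_left (hM x)
          (mul_nonneg (div_nonneg hC₀0 hR0.le) (hχnn x)))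
      have h3 : ‖⟪U x, eZ⟫‖ ≤ M := by
        calc ‖⟪U x, eZ⟫‖ ≤ ‖U x‖ * ‖(eZ : EuclideanSpace ℝ (Fin 3))‖ := norm_inner_le_norm _ _
          _ ≤ M := by rw [heZ, mul_one]; exact hM x
      have h5 : 0 ≤ C₀ / R * χ x * M :=
        mul_nonneg (mul_nonneg (div_nonneg hC₀0 hR0.le) (hχnn x)) hM0
      calc |fderiv ℝ φ x (U x)| * ‖⟪U x, eZ⟫‖ ≤ (C₀ / R * χ x * M) * M :=
            mul_le_mul h2 h3 (norm_nonneg _) h5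
        _ = C₀ * M ^ 2 / R * χ x := by ring
  -- collect
  rw [hid]
  have a1 := abs_le.1 hT1s
  have a2 := abs_le.1 hT2
  have hV0 : 0 ≤ V := setIntegral_nonneg (measurableSet_zSlab L 0) fun x _ => hχnn x
  have e1 : 3 * (C₀ * K₁ / R * V) ≤ 96 * C₀ * K₁ * L * R := by
    have h1 : 3 * (C₀ * K₁ / R * V) ≤ 3 * (C₀ * K₁ / R * (32 * L * R ^ 2)) :=
      mul_le_mul_of_nonneg_left (mul_le_mul_of_nonneg_left hV (by positivity)) (by norm_num)
    have h2 : 3 * (C₀ * K₁ / R * (32 * L * R ^ 2)) = 96 * C₀ * K₁ * L * R := by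
      field_simp; ring
    linarith
  have e2 : C₀ * M ^ 2 / R * V ≤ 32 * C₀ * M ^ 2 * L * R := by
    have h1 : C₀ * M ^ 2 / R * V ≤ C₀ * M ^ 2 / R * (32 * L * R ^ 2) :=
      mul_le_mul_of_nonneg_left hV (by positivity)
    have h2 : C₀ * M ^ 2 / R * (32 * L * R ^ 2) = 32 * C₀ * M ^ 2 * L * R := by
      field_simp
    linarith
  rw [abs_le]
  constructor <;> nlinarith [a1.1, a1.2, a2.1, a2.2, e1, e2]

/-! ### Periodicity of the pressure -/

/-- **The pressure of a bounded axially periodic steady flow is axially periodic** (Han–Wang–Xie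
2023, Lemma 2.7; Bang–Gui–Wang–Xie 2025). Let `(U, P)` be a smooth steady solution of the
unforced Navier–Stokes system on `ℝ³` at unit viscosity (`IsSteadyClassicalNS 1 0 U P`) with
`U` bounded and axially `L`-periodic (`L > 0`). Then `P` is axially `L`-periodic. -/
theorem steady_pressure_periodic {L M : ℝ} (hL : 0 < L)
    {U : EuclideanSpace ℝ (Fin 3) → EuclideanSpace ℝ (Fin 3)} {P : EuclideanSpace ℝ (Fin 3) → ℝ}
    (h : IsSteadyClassicalNS 1 0 U P) (hM : ∀ x, ‖U x‖ ≤ M) (hUper : IsAxiallyPeriodic L U) :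
    IsAxiallyPeriodic L P := by
  obtain ⟨K₁, K₂, K₃, -, -, -, hK⟩ := steady_derivative_bounds one_pos h hM
  obtain ⟨C₀, hC₀0, hC₀⟩ := exists_norm_fderiv_cylCutoff_le
  obtain ⟨hqper, -⟩ := steady_pressure_partial h hUper
  have hP1 : ContDiff ℝ 1 P := contDiff_infty.1 h.smooth_pressure 1
  have hqc : Continuous fun y => fderiv ℝ P y eZ :=
    (hP1.continuous_fderiv one_ne_zero).clm_apply continuous_const
  -- the constant period defect
  set c₀ : ℝ := P (L • eZ) - P 0 with hc₀
  have hdef : ∀ x, P (x + L • eZ) - P x = c₀ := fun x => steady_pressure_defect h hUper x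
  -- `c₀ ∫_S φ_R = L ∫_S φ_R ∂₃P` for every `R ≥ 1`
  set C : ℝ := 96 * C₀ * K₁ * L + 32 * C₀ * M ^ 2 * L with hC
  have hkey : ∀ R : ℝ, 1 ≤ R → |c₀| * (R ^ 2 * L) ≤ L * (C * R) := by
    intro R hR
    have hR0 : 0 < R := by linarith
    have hr2 : R < 2 * R := by linarith
    set φ : EuclideanSpace ℝ (Fin 3) → ℝ := cylCutoff R (2 * R) with hφ
    have hφc : Continuous φ := (contDiff_cylCutoff R (2 * R) (n := 0)).continuous
    have hφnn : ∀ x, 0 ≤ φ x := cylCutoff_nonneg R (2 * R)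
    have hφle : ∀ x, φ x ≤ 1 := cylCutoff_le_one R (2 * R)
    have hφzero : ∀ x, 2 * R ≤ cylRadius x → φ x = 0 := fun x hx => cylCutoff_eq_zero hR0.le hr2 hx
    have hφz : ∀ (x : EuclideanSpace ℝ (Fin 3)) (s : ℝ), φ (x + s • eZ) = φ x :=
      fun x s => cylCutoff_add_smul_eZ R (2 * R) x s
    have havg := setIntegral_zSlab_mul_verticalIntegral_real hL hφc.measurable hφz (G := 1)
      (fun x => by rw [abs_of_nonneg (hφnn x)]; exact hφle x) (ρ := 2 * R) hφzero hqc hqper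
    have hmean : ∀ x, ∫ s in (0 : ℝ)..L, fderiv ℝ P (x + s • eZ) eZ = c₀ := fun x => by
      rw [verticalIntegral_fderiv_eZ hP1 x, hdef x]
    simp_rw [hmean] at havg
    rw [integral_mul_const] at havg
    -- `havg : (∫_S φ) * c₀ = L * ∫_S φ ∂₃P`
    have hflux := pressure_flux_bound hL h hUper hM (fun x => (hK x).1) hC₀0 hC₀ hR
    have hmass := le_setIntegral_zSlab_cylCutoff hL hR0
    have hI0 : 0 ≤ ∫ x in zSlab L 0, φ x :=
      setIntegral_nonneg (measurableSet_zSlab L 0) fun x _ => hφnn x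
    calc |c₀| * (R ^ 2 * L) ≤ |c₀| * ∫ x in zSlab L 0, φ x :=
          mul_le_mul_of_nonneg_left hmass (abs_nonneg _)
      _ = |(∫ x in zSlab L 0, φ x) * c₀| := by rw [abs_mul, abs_of_nonneg hI0, mul_comm]
      _ = L * |∫ x in zSlab L 0, φ x * fderiv ℝ P x eZ| := by
          rw [havg, abs_mul, abs_of_pos hL]
      _ ≤ L * (C * R) := mul_le_mul_of_nonneg_left hflux hL.le
  -- hence `c₀ = 0`
  have hc0 : c₀ = 0 := by
    by_contra hne
    have hpos : 0 < |c₀| := abs_pos.2 hne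
    have hC0 : 0 ≤ C := by
      have := hkey 1 le_rfl
      nlinarith
    set R : ℝ := C / |c₀| + 1 with hR
    have hR1 : 1 ≤ R := by rw [hR]; have := div_nonneg hC0 hpos.le; linarith
    have h1 := hkey R hR1
    -- `|c₀| R² L ≤ L C R` gives `|c₀| R ≤ C`, but `|c₀| R = C + |c₀| > C`
    have h2 : |c₀| * R ≤ C := by
      have hR0 : 0 < R := by linarith
      have : |c₀| * R * (R * L) ≤ C * (R * L) := by nlinarith
      exact le_of_mul_le_mul_right this (by positivity)
    have h3 : |c₀| * R = C + |c₀| := by rw [hR]; field_simp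
    linarith
  intro x
  have := hdef x
  rw [hc0, sub_eq_zero] at this
  exact this

end Summit.NavierStokesRegularity.NavierStokesRegularity.Theorems.ScenarioCensus.HelicalSlab

end
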